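import Summits.BirchSwinnertonDyer.BirchSwinnertonDyer.Theorems.SignedLowerHalvesSmallImageLowerHalfBothSignsRttD2AuxIdealSupply
import Literature.NumberTheory.EllipticCurves.ZpExtensionCyclotomicUnramifiedPrimeNonsplitProofs
import HarnessLib

/-!
# Route `SignedLowerHalves`, crux L `SmallImageLowerHalfBothSigns` (stmt-BirchSwinnertonDyer-23599), line `rtt_w3` v14 — E2, row «𝔞»:
# THE RESIDUAL WITNESS `g` («`χ̄_p·θ̄ ≢ 1 (mod 𝔪_𝒪)`») IS AN INERTIA ELEMENT AT `p`, so row «𝔞» CLOSES OUTRIGHT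

WHY (HELPER-TABLE v14, row «𝔞»; BRIEF-E2 rev 4 §3 row «𝔞»; LEAD `cruxlead-stmt-BirchSwinnertonDyer-23599` g11). honda g23's supply
`SmallImageRttD2AuxIdeal.exists_auxIdeal_isUnit_map_nsub` (p781713) produces an admissible auxiliary ideal `𝔞` with `φ (N𝔞 − σ_𝔞)` a unit of
`Λ_𝒪` — the input of -w3 g19's `map_mkQ_Z_eq_span_zetaSp_of_isUnit` (the specialised zeta module is cyclic on ONE class `ζ̄`) — from ONE
witness `g ∈ Γ_K` with `χ_p(g)·θ(g) − 1 ∈ 𝒪ˣ`, for honda's finite-order twist character `θ : Γ_K → 𝒪ˣ` trivial on `Gal(K̄/K(𝔣))`, and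
leaves the choice of `g` to the LEAD. THIS FILE supplies it: for `p` ODD, unramified in the Galois number field `K` (crux: `K` quadratic,
`p ∤ d_K`), and a place `w ∣ p` with `𝔣 ⊄ w` (crux: `p ∤ N𝔪`), take `g = τ` an element of the inertia group `I_𝔓 ≤ Γ_K` of the prime
`𝔓 ∣ w` of `\bar ℤ_K` cut out by `K̄ → \bar K_w` with `χ_p(τ) = −1` (honda g21's `ZpExtension.exists_mem_inertia_cyclotomicCharacter_eq_of_isUnramifiedIn`:
`χ_p(I_𝔓) = ℤ_pˣ` above an unramified prime — `ℚ(μ_{p^∞})/ℚ` is totally ramified at `p`); the ray class field `K(𝔣)` is unramified at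
`w ∤ 𝔣` (tree `isUnramifiedIn_rayClassField`, `isUnramifiedIn_iff_forall_inertia_absRestrictNormalHom_eq_one`), so `I_𝔓` fixes `K(𝔣)`
pointwise and `θ(τ) = 1`; hence `χ_p(τ)θ(τ) − 1 = −2 ∈ ℤ_pˣ ↦ 𝒪ˣ`. Equivalently: `μ_p ⊄ K(𝔣)` because `p` is unramified in `K(𝔣)/ℚ`.

* `inertia_le_absGaloisFixingSubgroup_rayClassField` — `I_𝔓 ≤ Gal(K̄/K(𝔣))` for `𝔓 ∣ w`, `w ∤ 𝔣` (`𝔣 ≠ 0`);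
* `isUnit_neg_one_sub_one` — `−1 − 1 ∈ ℤ_pˣ` for `p ≠ 2`;
* ★★ `exists_isUnit_cyclotomicCharacter_mul_sub_one` — the witness `g` (= hypothesis `hg` of p781713's three supply theorems VERBATIM);
* `not_le_asIdeal_of_not_dvd_absNorm` — `p ∤ N𝔣 ⟹ 𝔣 ⊄ w` for `w ∣ p` (the crux's `hcop` currency);
* ★★★ `exists_auxIdeal_isUnit_map_nsub_of_isUnramifiedIn` — honda's ★★★ with `hg` DISCHARGED (hypotheses: `p ≠ 2`, `K/ℚ` Galois with
  `(p)` unramified, a place `w ∣ p` with `𝔣 ⊄ w`), and ★★★ `exists_auxIdeal_isUnit_map_nsub_of_not_dvd_discr` — the same in the registered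
  stub's currency (`[K:ℚ] = 2`, `hnd : ¬ (p : ℤ) ∣ d_K`, `p ∤ N𝔣`, `(p) ∈ w`).

THEOREMS ONLY (`--supports stmt-BirchSwinnertonDyer-23599` helper); closes nothing; crux L, crux M, E2 and BSD remain OPEN and are proved
for NO curve by any of this.
[cite: NeukirchANT1999, Ch. II (7.13) (ℚ_p(ζ_{p^n})/ℚ_p totally ramified), Ch. VI §6 Def. (6.2) and Cor. (6.6) (K^𝔪 unramified outside 𝔪), Ch. VII §10 Thm. (10.6) (proof)]
[cite: Washington1997, §13.1] [cite: JohnsonLeungKings2011, §5.1 (arXiv p0014:L12–43: `N𝔞 − σ_𝔞`, `𝔞` prime to `6p𝔣`)]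
-/

set_option autoImplicit false
-- the Theorems namespace of this sub repeats the summit name by design (D-0017 nested layout)
set_option linter.dupNamespace false

noncomputable section

open scoped NumberField
open Field IsDedekindDomain NumberField
open Literature.NumberTheory.GaloisRepresentations
open Literature.NumberTheory.EllipticCurves
open Literature.NumberTheory.ComplexMultiplication.EllipticUnits
open Literature.NumberTheory.ComplexMultiplication.EllipticUnits.JohnsonLeungKings2011
open Literature.NumberTheory.NumberFields (rayClassField isUnramifiedIn_rayClassField
  isUnramifiedIn_iff_forall_inertia_absRestrictNormalHom_eq_one absRestrictNormalHom_eq_one_iff_forall_smul)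

namespace Summit.BirchSwinnertonDyer.BirchSwinnertonDyer.Theorems.SmallImageRttD2AuxIdeal

variable {K : Type} [Field K] [NumberField K] {p : ℕ} [Fact p.Prime] {𝔣 : Ideal (𝓞 K)}

/-! ## §1 The inertia groups at `w ∤ 𝔣` fix the ray class field `K(𝔣)` -/

omit [Fact p.Prime] in
/-- **`I_𝔓 ≤ Gal(K̄/K(𝔣))` for every prime `𝔓 ∣ w` of `\bar ℤ_K`, `w ∤ 𝔣`**: the ray class field `K(𝔣)` is unramified at `w`
(`isUnramifiedIn_rayClassField`), so every inertia group above `w` dies in `Gal(K(𝔣)/K)`, i.e. fixes `K(𝔣)` pointwise.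
[cite: NeukirchANT1999, Ch. VI §6 Def. (6.2) and Cor. (6.6); Ch. VII §10 Thm. (10.6) (proof)] -/
theorem inertia_le_absGaloisFixingSubgroup_rayClassField (h𝔣 : 𝔣 ≠ ⊥) {w : HeightOneSpectrum (𝓞 K)}
    (h𝔣w : ¬ 𝔣 ≤ w.asIdeal) {𝔓 : Ideal (absIntegers (𝓞 K) K)} (h𝔓 : 𝔓 ∈ w.primesAbove) :
    𝔓.inertia (absoluteGaloisGroup K) ≤ absGaloisFixingSubgroup (rayClassField K 𝔣) := by
  intro τ hτ
  have h1 := (isUnramifiedIn_iff_forall_inertia_absRestrictNormalHom_eq_one (rayClassField K 𝔣) w).mp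
    (isUnramifiedIn_rayClassField h𝔣 h𝔣w) 𝔓 h𝔓 τ hτ
  rw [absRestrictNormalHom_eq_one_iff_forall_smul] at h1
  exact (mem_absGaloisFixingSubgroup_iff (rayClassField K 𝔣) τ).mpr fun x hx ↦ h1 ⟨x, hx⟩

/-! ## §2 The witness -/

/-- `−1 − 1 = −2` is a unit of `ℤ_p` for `p ≠ 2`. [folklore] -/
theorem isUnit_neg_one_sub_one (hp2 : p ≠ 2) : IsUnit ((-1 : ℤ_[p]) - 1) := by
  have hp : p.Prime := Fact.out
  have h2 : IsUnit ((2 : ℤ) : ℤ_[p]) := by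
    rw [PadicInt.isUnit_iff]
    refine le_antisymm (PadicInt.norm_le_one _) (not_lt.mp fun hlt ↦ ?_)
    have hdvd : (p : ℤ) ∣ 2 := (PadicInt.norm_int_lt_one_iff_dvd 2).mp hlt
    have hdvd' : p ∣ 2 := by exact_mod_cast hdvd
    rcases (Nat.dvd_prime Nat.prime_two).mp hdvd' with h | h
    · exact hp.one_lt.ne' h
    · exact hp2 h
  have e : ((-1 : ℤ_[p]) - 1) = -((2 : ℤ) : ℤ_[p]) := by push_cast; ring
  rw [e]
  exact h2.neg

/-- ★★ **The residual witness «`χ̄_p·θ̄ ≢ 1`» is an inertia element at `p`.** Let `K/ℚ` be Galois with `(p)` unramified in `𝓞 K`, `p ≠ 2`,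
`w ∣ p` a place with `𝔣 ⊄ w` (`𝔣 ≠ 0`), and `θ : Γ_K → 𝒪ˣ` (`𝒪 = 𝒪_{ℚ_p(S)}`) continuous and trivial on `Gal(K̄/K(𝔣))`. Then some
`g ∈ Γ_K` has `χ_p(g)·θ(g) − 1 ∈ 𝒪ˣ`: an inertia element `τ ∈ I_𝔓`, `𝔓 ∣ w`, with `χ_p(τ) = −1` (`χ_p(I_𝔓) = ℤ_pˣ`,
`ZpExtension.exists_mem_inertia_cyclotomicCharacter_eq_of_isUnramifiedIn`) fixes `K(𝔣)` (§1), so `θ(τ) = 1` and `χ_p(τ)θ(τ) − 1 = −2`.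
This is the hypothesis `hg` of `exists_prime_isTwist_isUnit_absNorm_sub_inv` / `exists_auxIdeal_isUnit_absNorm_sub_thetaArtinO_inv` /
`exists_auxIdeal_isUnit_map_nsub` (p781713) VERBATIM. [cite: NeukirchANT1999, Ch. II (7.13); Ch. VI §6 Cor. (6.6)] [cite: Washington1997, §13.1] -/
theorem exists_isUnit_cyclotomicCharacter_mul_sub_one (S : Set (PadicAlgCl p)) [IsGalois ℚ K] (hp2 : p ≠ 2) (h𝔣 : 𝔣 ≠ ⊥)
    (hunr : ∀ u₀ : HeightOneSpectrum (𝓞 ℚ), ((p : ℕ) : 𝓞 ℚ) ∈ u₀.asIdeal → Algebra.IsUnramifiedIn (𝓞 K) u₀.asIdeal)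
    {w : HeightOneSpectrum (𝓞 K)} (hpw : ((p : ℕ) : 𝓞 K) ∈ w.asIdeal) (h𝔣w : ¬ 𝔣 ≤ w.asIdeal)
    (θ : absoluteGaloisGroup K →ₜ* (padicCoeffIntegers S)ˣ)
    (hθ𝔣 : ∀ σ ∈ absGaloisFixingSubgroup (rayClassField K 𝔣), θ σ = 1) :
    ∃ g : absoluteGaloisGroup K, IsUnit (padicIntToCoeffIntegers S ((GaloisRep.cyclotomicCharacter K p g : ℤ_[p]ˣ) : ℤ_[p]) *
      ((θ g : (padicCoeffIntegers S)ˣ) : padicCoeffIntegers S) - 1) := by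
  obtain ⟨τ, hτI, hτχ⟩ := ZpExtension.exists_mem_inertia_cyclotomicCharacter_eq_of_isUnramifiedIn hunr hpw
    (adicCompletionPrime_mem_primesAbove K w) (-1)
  refine ⟨τ, ?_⟩
  have hθ : θ τ = 1 :=
    hθ𝔣 τ (inertia_le_absGaloisFixingSubgroup_rayClassField h𝔣 h𝔣w (adicCompletionPrime_mem_primesAbove K w) hτI)
  rw [hθ, hτχ, Units.val_one, mul_one, Units.val_neg, Units.val_one, ← map_one (padicIntToCoeffIntegers S), ← map_sub]
  exact (isUnit_neg_one_sub_one hp2).map _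

/-! ## §3 Row «𝔞» closed: honda's supply with `hg` discharged -/

omit [Fact p.Prime] in
/-- **`p ∤ N𝔣 ⟹ 𝔣 ⊄ w` for a place `w ∋ p`**: `N w ∣ N𝔣` when `𝔣 ⊆ w`, and `p ∣ N w` since `N w ∈ w ∋ p` and `w ≠ ⊤`
(`Ideal.absNorm_mem`, Bézout). The crux's `hcop : ¬ p ∣ d_K · N𝔪` in place currency. [folklore] -/
theorem not_le_asIdeal_of_not_dvd_absNorm (hp : p.Prime) {w : HeightOneSpectrum (𝓞 K)} (hpw : ((p : ℕ) : 𝓞 K) ∈ w.asIdeal)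
    (h𝔣p : ¬ p ∣ Ideal.absNorm 𝔣) : ¬ 𝔣 ≤ w.asIdeal := by
  intro hle
  apply h𝔣p
  refine dvd_trans ?_ (Ideal.absNorm_dvd_absNorm_of_le hle)
  -- `p ∣ N w`: otherwise `1 = a·p + b·N w ∈ w`
  by_contra hnd
  have hcop : Nat.Coprime p (Ideal.absNorm w.asIdeal) := (Nat.Prime.coprime_iff_not_dvd hp).mpr hnd
  have hN : ((Ideal.absNorm w.asIdeal : ℕ) : 𝓞 K) ∈ w.asIdeal := Ideal.absNorm_mem w.asIdeal
  obtain ⟨a, b, hab⟩ := Nat.isCoprime_iff_coprime.mpr hcop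
  have e : ((a : ℤ) : 𝓞 K) * ((p : ℕ) : 𝓞 K) + ((b : ℤ) : 𝓞 K) * ((Ideal.absNorm w.asIdeal : ℕ) : 𝓞 K) = 1 := by
    have h := congrArg (Int.cast : ℤ → 𝓞 K) hab
    push_cast at h
    exact h
  have h1 : (1 : 𝓞 K) ∈ w.asIdeal := by
    rw [← e]
    exact Ideal.add_mem _ (Ideal.mul_mem_left _ _ hpw) (Ideal.mul_mem_left _ _ hN)
  exact w.isPrime.ne_top ((Ideal.eq_top_iff_one _).mpr h1)

section Honda

open PowerSeries

variable (S : Set (PadicAlgCl p))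

/-- ★★ **Supply of an admissible `𝔞 ∈ AuxIdeals p 𝔣` with `IsUnit ((N𝔞 : 𝒪) − (thetaArtinO S θ 𝔣 𝔞)⁻¹)`, witness-free form**: honda's
`exists_auxIdeal_isUnit_absNorm_sub_thetaArtinO_inv` (p781713) with its hypothesis `hg` DISCHARGED by §2 (`K/ℚ` Galois, `(p)` unramified,
`p ≠ 2`, a place `w ∣ p` with `𝔣 ⊄ w`). [cite: JohnsonLeungKings2011, §5.1 (arXiv p0014:L12–43)] [cite: NeukirchANT1999, Ch. II (7.13); Ch. VI §6 Cor. (6.6)] -/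
theorem exists_auxIdeal_isUnit_absNorm_sub_thetaArtinO_inv_of_isUnramifiedIn [IsTotallyComplex K] [IsGalois ℚ K] (hp2 : p ≠ 2)
    (h𝔣 : 𝔣 ≠ ⊥) (hunr : ∀ u₀ : HeightOneSpectrum (𝓞 ℚ), ((p : ℕ) : 𝓞 ℚ) ∈ u₀.asIdeal → Algebra.IsUnramifiedIn (𝓞 K) u₀.asIdeal)
    {w : HeightOneSpectrum (𝓞 K)} (hpw : ((p : ℕ) : 𝓞 K) ∈ w.asIdeal) (h𝔣w : ¬ 𝔣 ≤ w.asIdeal)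
    (θ : absoluteGaloisGroup K →ₜ* (padicCoeffIntegers S)ˣ)
    (hθ𝔣 : ∀ σ ∈ absGaloisFixingSubgroup (rayClassField K 𝔣), θ σ = 1) :
    ∃ 𝔞 : AuxIdeals p 𝔣, IsUnit ((Ideal.absNorm 𝔞.1 : padicCoeffIntegers S) -
      (((thetaArtinO S θ 𝔣 𝔞)⁻¹ : (padicCoeffIntegers S)ˣ) : padicCoeffIntegers S)) := by
  obtain ⟨g, hg⟩ := exists_isUnit_cyclotomicCharacter_mul_sub_one S hp2 h𝔣 hunr hpw h𝔣w θ hθ𝔣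
  exact exists_auxIdeal_isUnit_absNorm_sub_thetaArtinO_inv S h𝔣 θ hθ𝔣 hg

variable {S} {κ₁ κ₂ : ZpExtension K p} {γ₁ γ₂ : absoluteGaloisGroup K}
  {θ : absoluteGaloisGroup K →ₜ* (padicCoeffIntegers S)ˣ} {ι : K →+* ℂ}
  (D : TwistedIwasawaDataO S κ₁ κ₂ γ₁ γ₂ θ 𝔣 ι)

/-- ★★★ **Row «𝔞» CLOSED: there is an admissible `𝔞` with `φ (N𝔞 − σ_𝔞)` a unit of `Λ_𝒪`**, for honda's pinned datum
`D : TwistedIwasawaDataO …` (p776397) and any abstract inner evaluation `φ` at `b ∈ 𝔪_𝒪` — honda's `exists_auxIdeal_isUnit_map_nsub`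
(p781713 = the LEAD's `isUnit_map_nsub_iff` p779551 ∘ Čebotarev) with its hypothesis `hg` DISCHARGED by §2. Hypotheses: `K` totally complex
and Galois over `ℚ`, `(p)` unramified in `𝓞 K`, `p ≠ 2`, `𝔣 ≠ 0`, a place `w ∣ p` with `𝔣 ⊄ w`, `θ` trivial on `Gal(K̄/K(𝔣))`. Output = the
hypothesis of -w3 g19's `map_mkQ_Z_eq_span_zetaSp_of_isUnit` (the cyclic specialised zeta module `R∙ζ̄` of the road-D frame, binder `hζ` of
`SmallImageRttCharRoad.charRoad_E2_of_roadD_junction`). [cite: JohnsonLeungKings2011, §5.1–§5.2 (arXiv p0014:L12–43, L80–99)]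
[cite: NeukirchANT1999, Ch. II (7.13); Ch. VI §6 Cor. (6.6)] -/
theorem exists_auxIdeal_isUnit_map_nsub_of_isUnramifiedIn [IsTotallyComplex K] [IsGalois ℚ K]
    [IsLocalRing (padicCoeffIntegers S)] (hp2 : p ≠ 2) (h𝔣 : 𝔣 ≠ ⊥)
    (hunr : ∀ u₀ : HeightOneSpectrum (𝓞 ℚ), ((p : ℕ) : 𝓞 ℚ) ∈ u₀.asIdeal → Algebra.IsUnramifiedIn (𝓞 K) u₀.asIdeal)
    {w : HeightOneSpectrum (𝓞 K)} (hpw : ((p : ℕ) : 𝓞 K) ∈ w.asIdeal) (h𝔣w : ¬ 𝔣 ≤ w.asIdeal)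
    (hθ𝔣 : ∀ σ ∈ absGaloisFixingSubgroup (rayClassField K 𝔣), θ σ = 1)
    {b : padicCoeffIntegers S} (hb : b ∈ IsLocalRing.maximalIdeal (padicCoeffIntegers S))
    (φ : PowerSeries (IwasawaAlgebraO S) →+* IwasawaAlgebraO S)
    (hφf : φ (C (X - C b)) = 0) (hC : ∀ a : padicCoeffIntegers S, φ (C (C a)) = C a) (hX : φ X = X)
    (hreg : ∀ a : AuxIdeals p 𝔣, IsSMulRegular (IwasawaAlgebraO₂ S) (D.nsub a)) :
    ∃ 𝔞 : AuxIdeals p 𝔣, IsUnit (φ ((D.toZetaSkeleton hreg).nsub 𝔞)) := by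
  obtain ⟨g, hg⟩ := exists_isUnit_cyclotomicCharacter_mul_sub_one S hp2 h𝔣 hunr hpw h𝔣w θ hθ𝔣
  exact exists_auxIdeal_isUnit_map_nsub D h𝔣 hθ𝔣 hg hb φ hφf hC hX hreg

/-- ★★★ **Row «𝔞» CLOSED in the registered stub's currency**: `[K:ℚ] = 2`, `hnd : ¬ (p : ℤ) ∣ d_K` (binder `hnd` of `stub_charRoad_ns`),
`p ≠ 2` (binder `hp`), `p ∤ N𝔣` (from `hcop : ¬ p ∣ d_K · N𝔪`), a place `w ∋ p` (the inert `vp`, binder `hv`). Then for honda's pinned datum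
`D` and any inner evaluation `φ` at `b ∈ 𝔪_𝒪` some admissible `𝔞` has `φ (N𝔞 − σ_𝔞) ∈ Λ_𝒪ˣ`.
[cite: JohnsonLeungKings2011, §5.1–§5.2 (arXiv p0014:L12–43, L80–99)] [cite: NeukirchANT1999, Ch. III §2 Cor. (2.12); Ch. II (7.13); Ch. VI §6 Cor. (6.6)] -/
theorem exists_auxIdeal_isUnit_map_nsub_of_not_dvd_discr [IsTotallyComplex K] [IsLocalRing (padicCoeffIntegers S)]
    (hK2 : Module.finrank ℚ K = 2) (hp2 : p ≠ 2) (hnd : ¬ (p : ℤ) ∣ NumberField.discr K) (h𝔣 : 𝔣 ≠ ⊥)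
    (h𝔣p : ¬ p ∣ Ideal.absNorm 𝔣) {w : HeightOneSpectrum (𝓞 K)} (hpw : ((p : ℕ) : 𝓞 K) ∈ w.asIdeal)
    (hθ𝔣 : ∀ σ ∈ absGaloisFixingSubgroup (rayClassField K 𝔣), θ σ = 1)
    {b : padicCoeffIntegers S} (hb : b ∈ IsLocalRing.maximalIdeal (padicCoeffIntegers S))
    (φ : PowerSeries (IwasawaAlgebraO S) →+* IwasawaAlgebraO S)
    (hφf : φ (C (X - C b)) = 0) (hC : ∀ a : padicCoeffIntegers S, φ (C (C a)) = C a) (hX : φ X = X)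
    (hreg : ∀ a : AuxIdeals p 𝔣, IsSMulRegular (IwasawaAlgebraO₂ S) (D.nsub a)) :
    ∃ 𝔞 : AuxIdeals p 𝔣, IsUnit (φ ((D.toZetaSkeleton hreg).nsub 𝔞)) := by
  haveI : Algebra.IsQuadraticExtension ℚ K := ⟨hK2⟩
  haveI : IsGalois ℚ K := inferInstance
  have hp : p.Prime := Fact.out
  exact exists_auxIdeal_isUnit_map_nsub_of_isUnramifiedIn D hp2 h𝔣
    (fun u₀ hu₀ ↦ ZpExtension.isUnramifiedIn_ringOfIntegers_of_not_dvd_discr' u₀ hp hu₀ hnd) hpw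
    (not_le_asIdeal_of_not_dvd_absNorm hp hpw h𝔣p) hθ𝔣 hb φ hφf hC hX hreg

end Honda

end Summit.BirchSwinnertonDyer.BirchSwinnertonDyer.Theorems.SmallImageRttD2AuxIdeal

end
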